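import Summits.CriticalPhenomena.PercolationContinuityZ3.Theorems.PercNearOneGluingNoHeavyPcintNawGrowth
import Summits.CriticalPhenomena.PercolationContinuityZ3.Theorems.PercNearOneGluingNoHeavyPcintClassCountLaw
import Summits.CriticalPhenomena.PercolationContinuityZ3.Theorems.PercNearOneGluingNoHeavyPcintNawRandMem
import HarnessLib

/-!
# CriticalPhenomena/PercolationContinuityZ3 — Theorems/PercNearOneGluingNoHeavyPcintSiteClassCountLaw.lean: STRUCTURE **C3-SITE** —
# the class-count identity and the price law for the SITE column's memory automaton (neighbour-avoiding walks), TYPED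

HONEST FRAMING: the SITE twin of `…PcintClassCountLaw` (C3, bond / pure self-avoidance memory).  It records an exact identity for the
SIZE of the lane's site-side memory automata (verified numerically to the unit and pre-registered, see below; the word-level census
link is PROVED here from gen 13's census theorems), and TYPES the conjectural growth / price clauses, whose bond versions are theorems
(`MemoryTail.tendsto_memStates_rpow`, `MemoryTail.priceLaw_holds`, gen 14) but whose site versions need a neighbour-avoiding pattern
theorem the tree does not have (gen 14 correction, HANDOFF 'PCINT-2 GEN 14').  Nothing here is used by a certified `p_c` cell.
Statement of record: run/shared/lean/prim/pcint/STRUCTURE.md v0.6 §1/§2 (C3-site); write-up prim-pcint-2/gen15/README.md.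

THE OBJECT.  The lane's site automata (Lean `nstep τ` of `…PcintNawRandMem`: refuse a step adjacent to a remembered site, else the
memory-`τ` update `mstep τ`; engines: STEP-0 `naw_cw`, pcint-1's B2d `nawfree` kernels, gen12/memmu.c `site=1`) run on dangerous sets
`danger τ v` of NEIGHBOUR-AVOIDING words `v` (`nstep_danger_pre`).  `nearNawWords d τ m` = the NAWs of length `m` with
`m + ‖ω(m)‖₁ ≤ τ`; `siteMemStates d τ := Σ_{m<τ} #nearNawWords d τ m`, PROVED equal to the number of distinct dangerous sets they
produce (`siteMemStates_eq_card_census`: gen 13's `danger_injOn_near` + `disjoint_census`).  The engines count `B_d`-ORBITS: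
`#classes = Σ_m Σ_k C(d,k) D_{d−k} A_k(m) / (2^d d!)`, `A_k(m)` = #near NAW words in `ℤ^k`, `D_j` = #signed permutations of `j` axes fixing
no axis positively = 1, 1, 5, 29, 233, 2329, 27949.

EVIDENCE LEDGER (gen15/c3site/nawnear.c + score_site2.py; ZERO TOLERANCE): retrodiction — site classes `d = 3`, τ = 4..16:
4, 11, 53, 401, 3907, 43655, 529295 (gen12/DATA.txt = pcint-1's B2d counts); `d = 4`, τ = 4..10: 4, 11, 62, 729; `d = 5`, τ = 12/14: 18197,
572655; `d ≥ 5`, τ = 8/10: 62, 798 — all exact.  PRE-REGISTERED P14 (sealed sha256 316cba80…, evidence on stmt-CriticalPhenomena-4575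
2026-08-23T14:35Z, before the seat read the corresponding DATA.txt lines): site `d = 4` τ = 12/14/16 = 12 932 / 281 096 / 6 854 798 and
`d = 6` τ = 12 = 18 925 — HIT ×4 EXACTLY; P14h (sha256 b52436dc…, 14:46Z): the SHIFTED PARITY LAW of the engines' site convention
(memmu `site=1`, reach slack +1: classes(2k) = classes(2k−1), μ^site_{2k} = μ^site_{2k−1}) — HIT ×9 EXACTLY (d3 τ = 5..13, d4 τ = 9/11,
d5/d6 τ = 11) with the bond control (d3 τ9 = τ8 = 237).  In the tree's convention (`nstep`, reach `τ − age`) the parity law is the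
bond one, PROVED below for the counts: `siteMemStates d (2k+1) = siteMemStates d (2k)`; and the site-specific fact that the TOP census
piece is EMPTY (`nearNawWords d (2k) (2k−1) = ∅`, `k ≥ 2`: a full-window history would put the oldest site next to the tip) — the
site automaton's effective memory is one step shorter than the bond automaton's at equal `τ` (STRUCTURE §4 N4, now exact).

THE LAW (conjectural part).  (i) GROWTH: `siteMemStates d τ` grows like `μ_NAW(ℤ^d)^τ` (`NawTail.nawConst`); (ii) PRICE LAW:
`siteMemStates d (2m+2)/siteMemStates d (2m) → μ_NAW(ℤ^d)²` (site `d = 3`: 11.17, 12.12, 12.77, 13.23 at τ = 14..20, rising; `μ_NAW(ℤ³)² ≈ 16.4`;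
`d = 4`: 21.7, 24.4, 26.2 at τ = 14..18).  The bond versions are theorems; the site versions wait for a NAW pattern theorem (Kesten's
swap `(U,Q) ↔ (V,Q)` is not neighbour-avoiding).  Written by prim-pcint-2 gen 15 (prover-prim-pcint-2-g15-0), 2026-08-23.
-/

noncomputable section

open Filter Topology
open Literature.Probability.LatticeModels Literature.Probability.Percolation
open Literature.Probability.RandomPlanarGeometry.SAW.Zd (connectiveConstant count zdGraph_adj_sub_right)
open Literature.Probability.FitznerVanDerHofstad2017 (wordPos_wordInit)
open Summit.CriticalPhenomena.PercolationContinuityZ3.Theorems.Pcint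
  (MState l1 danger mem_danger danger_zero runW runW_zero runW_succ nstep mstep_danger_wordInit isMem_of_isSAW)

namespace Summit.CriticalPhenomena.PercolationContinuityZ3.Theorems.Pcint.NawTail

variable {d : ℕ}

/-! ### The objects -/

open Classical in
/-- The NEAR neighbour-avoiding words of length `m` for memory `τ`: NAWs with `m + ‖ω(m)‖₁ ≤ τ` (all their sites are still
dangerous).  Their dangerous sets are the states of the memory-`τ` site automaton. [folklore] -/
def nearNawWords (d τ m : ℕ) : Finset (Fin m → Fin d × Bool) :=
  (nawWords d m).filter fun w => l1 (wordPos w m) ≤ τ - m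

/-- **`siteMemStates d τ`** = the number of states of the memory-`τ` neighbour-avoiding (site) dangerous-set automaton on `ℤ^d`
(`= Σ_{m<τ} #nearNawWords d τ m` by definition; `= #⋃ states` by `siteMemStates_eq_card_census`).  The lane's site class counts are
the numbers of `B_d`-orbits of these states. [folklore] -/
def siteMemStates (d τ : ℕ) : ℕ := ∑ m ∈ Finset.range τ, (nearNawWords d τ m).card

/-- Near NAWs are near SAWs: `nearNawWords ⊆ nearWords`. [folklore] -/
theorem nearNawWords_subset_nearWords (d τ m : ℕ) : nearNawWords d τ m ⊆ MemoryTail.nearWords d τ m := by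
  classical
  intro w hw
  unfold nearNawWords at hw
  unfold MemoryTail.nearWords
  rw [Finset.mem_filter] at hw ⊢
  exact ⟨nawWords_subset_sawWords d m hw.1, hw.2⟩

/-- `siteMemStates ≤ memStates` (the site automaton is never larger than the bond automaton). [folklore] -/
theorem siteMemStates_le_memStates (d τ : ℕ) : siteMemStates d τ ≤ MemoryTail.memStates d τ :=
  Finset.sum_le_sum fun m _ => Finset.card_le_card (nearNawWords_subset_nearWords d τ m)

open Classical in
/-- **Census link (PROVED)**: `siteMemStates d τ` is the number of distinct dangerous sets of the near neighbour-avoiding words —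
the dangerous-set map is injective on near words of each length (`danger_injOn_near`) and the length pieces are disjoint
(`disjoint_census`). [folklore] -/
theorem siteMemStates_eq_card_census (d τ : ℕ) :
    siteMemStates d τ = ((Finset.range τ).biUnion fun m => (nearNawWords d τ m).image (danger τ)).card := by
  classical
  rw [Finset.card_biUnion]
  · unfold siteMemStates
    refine Finset.sum_congr rfl fun m hm => ?_
    rw [Finset.card_image_of_injOn]
    intro w hw w' hw' h
    have hmτ : m ≤ τ - 1 := by have := Finset.mem_range.1 hm; omega
    refine MemoryTail.danger_injOn_near τ m hmτ ?_ ?_ h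
    · exact (Finset.mem_filter.1 (Finset.mem_coe.1 hw)).2
    · exact (Finset.mem_filter.1 (Finset.mem_coe.1 hw')).2
  · intro m₁ hm₁ m₂ hm₂ hne
    have h₁ : m₁ ≤ τ - 1 := by have := Finset.mem_range.1 (Finset.mem_coe.1 hm₁); omega
    have h₂ : m₂ ≤ τ - 1 := by have := Finset.mem_range.1 (Finset.mem_coe.1 hm₂); omega
    refine (MemoryTail.disjoint_census d τ h₁ h₂ hne).mono ?_ ?_
    · exact Finset.image_subset_image (fun w hw => Finset.mem_filter.2
        ⟨nawWords_subset_sawWords d m₁ (Finset.mem_filter.1 hw).1, (Finset.mem_filter.1 hw).2⟩)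
    · exact Finset.image_subset_image (fun w hw => Finset.mem_filter.2
        ⟨nawWords_subset_sawWords d m₂ (Finset.mem_filter.1 hw).1, (Finset.mem_filter.1 hw).2⟩)

/-- The initial segment of a NAW is a NAW. [folklore] -/
theorem IsNAW.wordInit {n : ℕ} {w : Fin (n + 1) → Fin d × Bool} (h : IsNAW w) : IsNAW (wordInit w) :=
  ⟨fun i j hi hj hij => h.1 i j (by omega) (by omega) (by rwa [wordPos_wordInit w hi, wordPos_wordInit w hj] at hij),
    fun i j hij hjn hadj => h.2 i j hij (by omega) (by rwa [wordPos_wordInit w (by omega), wordPos_wordInit w hjn] at hadj)⟩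

/-- **Every state counted is a state reached**: a neighbour-avoiding word is ACCEPTED by the lane's site automaton `nstep τ`
(`…PcintNawRandMem`) from the empty state and ends in its dangerous set (`τ ≥ 2`) — the NAW analogue of `runW_mstep_of_isMem`.
So the `siteMemStates d τ` dangerous sets of `siteMemStates_eq_card_census` are states of the automaton reachable from `∅`. [folklore] -/
theorem runW_nstep_of_isNAW {τ : ℕ} (hτ : 2 ≤ τ) :
    ∀ {n : ℕ} (w : Fin n → Fin d × Bool), IsNAW w → runW (nstep τ) n ∅ w = some (danger τ w) := by
  intro n
  induction n with
  | zero => intro w _; rw [runW_zero, danger_zero]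
  | succ n ih =>
    intro w h
    rw [runW_succ, show Fin.init w = wordInit w from rfl, ih (wordInit w) h.wordInit, Option.bind_some]
    unfold nstep
    rw [if_neg, mstep_danger_wordInit hτ w (isMem_of_isSAW τ h.1)]
    rintro ⟨q, hq, hadj⟩
    obtain ⟨h1, -, h3, hr, -⟩ := (mem_danger _ q).1 hq
    rw [wordPos_wordInit w (by omega), wordPos_wordInit w le_rfl] at hr
    have hlast : wordPos w (n + 1) - wordPos w n = stepVec (w (Fin.last n)) := by
      rw [wordPos_succ w n.lt_succ_self, add_sub_cancel_left]; rfl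
    rw [hr, ← hlast, zdGraph_adj_sub_right] at hadj
    exact h.2 (n - q.2) (n + 1) (by omega) le_rfl hadj

/-! ### Sanity: short NAWs are all near; monotonicity; parity; the empty top piece -/

/-- For `2m ≤ τ` every NAW of length `m` is near. [folklore] -/
theorem nearNawWords_eq_nawWords {τ m : ℕ} (h : 2 * m ≤ τ) (d : ℕ) : nearNawWords d τ m = nawWords d m := by
  classical
  unfold nearNawWords
  refine Finset.filter_true_of_mem fun w _ => ?_
  exact (MemoryTail.l1_wordPos_le w m le_rfl).trans (by omega)

/-- `nearNawWords` grows with the memory. [folklore] -/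
theorem nearNawWords_mono {τ τ' : ℕ} (h : τ ≤ τ') (d m : ℕ) : nearNawWords d τ m ⊆ nearNawWords d τ' m := by
  classical
  intro w hw
  unfold nearNawWords at hw ⊢
  rw [Finset.mem_filter] at hw ⊢
  exact ⟨hw.1, hw.2.trans (by omega)⟩

/-- `siteMemStates` is monotone in `τ`. [folklore] -/
theorem siteMemStates_mono {τ τ' : ℕ} (h : τ ≤ τ') (d : ℕ) : siteMemStates d τ ≤ siteMemStates d τ' := by
  unfold siteMemStates
  calc ∑ m ∈ Finset.range τ, (nearNawWords d τ m).card ≤ ∑ m ∈ Finset.range τ, (nearNawWords d τ' m).card :=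
        Finset.sum_le_sum fun m _ => Finset.card_le_card (nearNawWords_mono h d m)
    _ ≤ ∑ m ∈ Finset.range τ', (nearNawWords d τ' m).card :=
        Finset.sum_le_sum_of_subset_of_nonneg (Finset.range_subset_range.2 h) fun _ _ _ => Nat.zero_le _

/-- `siteMemStates d τ ≥ dᵐ`-type lower bound in its simplest form: for `2m + 1 ≤ τ`, `dᵐ ≤ siteMemStates d τ` (the positive-direction
words of length `m` are near NAWs). [folklore] -/
theorem pow_le_siteMemStates {τ m : ℕ} (h : 2 * m + 1 ≤ τ) (d : ℕ) : d ^ m ≤ siteMemStates d τ := by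
  classical
  unfold siteMemStates
  have hm : m ∈ Finset.range τ := Finset.mem_range.2 (by omega)
  refine le_trans ?_ (Finset.single_le_sum (f := fun m => (nearNawWords d τ m).card) (fun _ _ => Nat.zero_le _) hm)
  change d ^ m ≤ (nearNawWords d τ m).card
  rw [nearNawWords_eq_nawWords (by omega) d]
  exact pow_le_nawCount d m

/-- `1 ≤ siteMemStates d τ` for `τ ≥ 1` (the empty state). [folklore] -/
theorem one_le_siteMemStates {τ : ℕ} (hτ : 1 ≤ τ) (d : ℕ) : 1 ≤ siteMemStates d τ :=
  (pow_zero d).symm.le.trans (pow_le_siteMemStates (m := 0) (by omega) d)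

/-- An odd memory adds no near NAW (tree convention, reach `τ − age`): `nearNawWords d (2k+1) m = nearNawWords d (2k) m` (parity
`‖ω(m)‖₁ ≡ m`). [folklore] -/
theorem nearNawWords_odd (d k m : ℕ) : nearNawWords d (2 * k + 1) m = nearNawWords d (2 * k) m := by
  classical
  unfold nearNawWords
  refine Finset.filter_congr fun w _ => ?_
  have hp := MemoryTail.l1_wordPos_mod_two w m le_rfl
  constructor <;> intro h <;> omega

/-- There is no near NAW of length `2k` at memory `2k + 1` (`k ≥ 1`): it would be back at the origin. [folklore] -/
theorem nearNawWords_odd_top {k : ℕ} (hk : 1 ≤ k) (d : ℕ) : nearNawWords d (2 * k + 1) (2 * k) = ∅ := by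
  classical
  have h := MemoryTail.nearWords_odd_top hk d
  refine Finset.eq_empty_of_forall_notMem fun w hw => ?_
  have : w ∈ MemoryTail.nearWords d (2 * k + 1) (2 * k) := nearNawWords_subset_nearWords d _ _ hw
  rw [h] at this
  exact Finset.notMem_empty w this

/-- **Parity law for the site state count** (tree convention): `siteMemStates d (2k+1) = siteMemStates d (2k)`, `k ≥ 1`. [folklore] -/
theorem siteMemStates_odd {k : ℕ} (hk : 1 ≤ k) (d : ℕ) : siteMemStates d (2 * k + 1) = siteMemStates d (2 * k) := by
  unfold siteMemStates
  rw [Finset.sum_range_succ, nearNawWords_odd_top hk d, Finset.card_empty, add_zero]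
  exact Finset.sum_congr rfl fun m _ => by rw [nearNawWords_odd]

/-- A site at `ℓ¹`-distance `1` from the origin is one of the `2d` unit steps. [folklore] -/
theorem exists_eq_stepVec_of_l1_eq_one {x : Site d} (h : l1 x = 1) : ∃ a : Fin d × Bool, x = stepVec a := by
  classical
  unfold l1 at h
  obtain ⟨i, -, hi⟩ := Finset.exists_ne_zero_of_sum_ne_zero (h.trans_ne one_ne_zero)
  have hsplit := Finset.add_sum_erase Finset.univ (fun j => (x j).natAbs) (Finset.mem_univ i)
  rw [h] at hsplit
  have hi1 : (x i).natAbs = 1 := by omega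
  have hrest : ∑ j ∈ Finset.univ.erase i, (x j).natAbs = 0 := by omega
  have hzero : ∀ j, j ≠ i → x j = 0 := fun j hj => by
    have := Finset.sum_eq_zero_iff.1 hrest j (Finset.mem_erase.2 ⟨hj, Finset.mem_univ j⟩)
    exact Int.natAbs_eq_zero.1 this
  rcases Int.natAbs_eq_iff.1 hi1 with hpos | hneg
  · refine ⟨(i, true), funext fun j => ?_⟩
    by_cases hj : j = i
    · subst hj; simp [stepVec, hpos]
    · simp [stepVec, hj, hzero j hj]
  · refine ⟨(i, false), funext fun j => ?_⟩
    by_cases hj : j = i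
    · subst hj; simp [stepVec, hneg]
    · simp [stepVec, hj, hzero j hj]

/-- **The top census piece of the site automaton is EMPTY**: for `k ≥ 2` there is no near NAW of length `2k − 1` at memory `2k`
(its endpoint would be at `ℓ¹`-distance `1` from the origin, i.e. adjacent to it, `2k − 1 ≥ 3` steps back — a neighbour contact).
So a site state never holds a full window: its effective memory is one step shorter than the bond automaton's (STRUCTURE §4 N4,
P14/P14h). [folklore] -/
theorem nearNawWords_top_eq_empty {k : ℕ} (hk : 2 ≤ k) (d : ℕ) : nearNawWords d (2 * k) (2 * k - 1) = ∅ := by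
  classical
  unfold nearNawWords
  refine Finset.filter_false_of_mem fun w hw => ?_
  rw [mem_nawWords] at hw
  intro h
  have hp := MemoryTail.l1_wordPos_mod_two w (2 * k - 1) le_rfl
  have h1 : l1 (wordPos w (2 * k - 1)) = 1 := by omega
  obtain ⟨a, ha⟩ := exists_eq_stepVec_of_l1_eq_one h1
  refine hw.2 0 (2 * k - 1) (by omega) le_rfl ?_
  rw [wordPos_zero, zdGraph_adj_iff_stepVec]
  exact ⟨a, by rw [ha, zero_add]⟩

/-- Hence `siteMemStates d (2k)` is a sum over lengths `m ≤ 2k − 2` only (`k ≥ 2`). [folklore] -/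
theorem siteMemStates_even_eq_sum {k : ℕ} (hk : 2 ≤ k) (d : ℕ) :
    siteMemStates d (2 * k) = ∑ m ∈ Finset.range (2 * k - 1), (nearNawWords d (2 * k) m).card := by
  unfold siteMemStates
  rw [show 2 * k = (2 * k - 1) + 1 from by omega, Finset.sum_range_succ,
    show 2 * k - 1 + 1 = 2 * k from by omega, nearNawWords_top_eq_empty hk d, Finset.card_empty, add_zero]

/-! ### The law (conjectural part), typed -/

/-- **C3-site (i), GROWTH**: for every `d ≥ 2` the site automaton grows at the NAW connective constant:
`(siteMemStates d τ)^{1/τ} → μ_NAW(ℤ^d)`.  (Bond version PROVED: `MemoryTail.tendsto_memStates_rpow`, via closing-walk lower bounds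
that have no neighbour-avoiding counterpart in the tree.)  Evidence: site `d = 3` class counts 401 → 89 414 992 (τ = 10..20) with
per-rung factors 9.7 → 13.2 rising toward `μ_NAW(ℤ³)² ≈ 16.4`.  STRUCTURE CONJ C3-site (prim-pcint-2 gen 15, 2026-08-23; not kernel-checked). -/
@[conjecture] def siteGrowthLaw : Prop :=
  ∀ d : ℕ, 2 ≤ d →
    Tendsto (fun τ : ℕ => (siteMemStates d τ : ℝ) ^ (1 / (τ : ℝ))) atTop (𝓝 (nawConst d))

/-- **C3-site (ii), PRICE LAW**: for every `d ≥ 2`, along even memories the cost of one more site-memory rung tends to `μ_NAW(ℤ^d)²`: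
`siteMemStates d (2m+2) / siteMemStates d (2m) → μ_NAW(ℤ^d)²`.  (Bond version PROVED: `MemoryTail.priceLaw_holds`, by Kesten's pattern
argument; the site version needs a neighbour-avoiding pattern theorem.)  Evidence: site `d = 3` ratios 11.17 / 12.12 / 12.77 / 13.23
(τ = 14..20), `d = 4`: 21.7 / 24.4 / 26.2 (τ = 14..18), `d = 5`: 31.5 (τ = 14), `d = 6`: 35.7 (τ = 14), all rising; limits `μ_NAW²`
≈ 16.4 (`d = 3`, lane extrapolation `μ_NAW ≈ 4.046`).  STRUCTURE CONJ C3-site (prim-pcint-2 gen 15, 2026-08-23; not kernel-checked). -/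
@[conjecture] def sitePriceLaw : Prop :=
  ∀ d : ℕ, 2 ≤ d →
    Tendsto (fun m : ℕ => (siteMemStates d (2 * m + 2) : ℝ) / siteMemStates d (2 * m)) atTop (𝓝 (nawConst d ^ 2))

end Summit.CriticalPhenomena.PercolationContinuityZ3.Theorems.Pcint.NawTail
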